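import Summits.QuantumAdvantage.QuantumAdvantage.Theorems.CubicForrelationNearExactIsExactTwelveLevelFiveAlphaIso

/-!
# Crux `CubicForrelation.NearExactIsExact` (stmt-QuantumAdvantage-14043) — n = 12, open window, a LEVEL-5 side in CASE α: the sign `σ₅` is
  relatively AFFINE on every `V₁`-coset of `P`, hence `Σ_{x∈P} σ₅(x)(−1)^{x·y} ∈ 256ℤ` for every frequency `y`

Certificate seat `b2b-cforr-cert` (gen 30).  HONEST FRAMING: kernel-checked finite-slice lemmas (standard axioms) about cubic Boolean pairs on 12
bits; consequences of the isotropy lemma `tzi_iso` used by the case-α kill.  NO value of `θ₁₂` claimed; NOT summit progress.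

* `tzj_coset_affine`: on the window in case α, `hb(x ⊕ w₁ ⊕ w₂) = hb(x) ⊕ hb(x ⊕ w₁) ⊕ hb(x ⊕ w₂)` for `x ∈ P`, `w₁, w₂ ∈ V₁`
  (`hb = [e₅ ≡ 3 (mod 4)]`; from `tzi_hsd` + `tzi_iso` for the twisted bit `hb'`, whose twist is constant on `V₁`-cosets).
* `tzj_sigma_char`: `Σ_{x∈P} σ₅(x)(−1)^{x·y} = 256·k` with `k ∈ ℤ` (`P = x₀ ⊕ V` is the disjoint union of the `8` cosets of `V₁`; on each,
  `tzb_coset_char` gives `0` or `±256`).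

References: MacWilliams–Sloane (1977) Ch. 15 §2; R. O'Donnell (2014) §1.4.  Axioms: the standard three.
-/

set_option linter.dupNamespace false -- D-0017: single-problem summit ⇒ `QuantumAdvantage.QuantumAdvantage` by design

noncomputable section

namespace Summit.QuantumAdvantage.QuantumAdvantage.Theorems.CubicForrelation.NearExactIsExact

open Finset
open Literature.Computability.QuantumComplexity
open Literature.Computability.QuantumComplexity.BuzetChailloux (bxor zeroVec bxor_bxor_cancel_left bxor_zeroVec zeroVec_bxor bxor_comm
  bxor_self)
open Literature.Computability.QuantumComplexity.DerivativeWalsh (W)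
open Summit.QuantumAdvantage.QuantumAdvantage.Theorems.CubicForrelation.ExactPairsMaioranaMcFarland (dv_bxor_right_comm)

/-- **`hb` is relatively affine on every `V₁`-coset of `P`.**  On the window in case α: for `x ∈ P` and `w₁, w₂ ∈ V₁`,
`hb(x ⊕ w₁ ⊕ w₂) = hb(x) ⊕ hb(x ⊕ w₁) ⊕ hb(x ⊕ w₂)`, `hb = [u' − 2(−1)^f ≡ 3 (mod 4)]`.  Finite-slice statement, NOT summit
progress. [this work] -/
theorem tzj_coset_affine (f g : (Fin (6 + 6) → Bool) → Bool) (hf : IsDegLeFun 3 f) (hg : IsDegLeFun 3 g)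
    (u' : (Fin (6 + 6) → Bool) → ℤ) (hu' : ∀ x, W (fun y => signOf (g y)) x = (2 : ℝ) ^ 5 * (u' x : ℝ))
    (V : Finset (Fin (6 + 6) → Bool)) (x₀ : Fin (6 + 6) → Bool) (h0 : zeroVec ∈ V) (hadd : ∀ a ∈ V, ∀ b ∈ V, bxor a b ∈ V)
    (hcardV : #V = 2048) (hP : (univ.filter fun x : Fin (6 + 6) → Bool => Odd (u' x)) = V.image (bxor x₀))
    (c : Fin (6 + 6) → Bool) (V₁ : Finset (Fin (6 + 6) → Bool)) (hsub : V₁ ⊆ V) (h10 : zeroVec ∈ V₁)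
    (h1add : ∀ a ∈ V₁, ∀ b ∈ V₁, bxor a b ∈ V₁) (h1card : #V₁ = 256)
    (hPc : (univ.filter fun x : Fin (6 + 6) → Bool => ¬ Odd (u' x)) = V.image (bxor c))
    (hA2 : (univ.filter fun y : Fin (6 + 6) → Bool => ¬ Odd (u' y) ∧ ¬ (4 : ℤ) ∣ u' y - 2 * sZ (f y)) = V₁.image (bxor c))
    (hper : ∀ v ∈ V₁, ∀ y, ¬ Odd (u' y) →
      ((4 : ℤ) ∣ u' (bxor y v) - 2 * sZ (f (bxor y v)) ↔ (4 : ℤ) ∣ u' y - 2 * sZ (f y)))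
    (hbud : ∑ x ∈ univ.filter (fun x : Fin (6 + 6) → Bool => Odd (u' x)), ((u' x - 2 * sZ (f x)) ^ 2 - 1) +
        ∑ y ∈ univ.filter (fun y : Fin (6 + 6) → Bool => ¬ Odd (u' y)), (u' y - 2 * sZ (f y)) ^ 2 ≤ 1535)
    {x w₁ w₂ : Fin (6 + 6) → Bool} (hx : Odd (u' x)) (hw₁ : w₁ ∈ V₁) (hw₂ : w₂ ∈ V₁) :
    decide ((u' (bxor (bxor x w₁) w₂) - 2 * sZ (f (bxor (bxor x w₁) w₂))) % 4 = 3) =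
      (decide ((u' x - 2 * sZ (f x)) % 4 = 3) ^^ decide ((u' (bxor x w₁) - 2 * sZ (f (bxor x w₁))) % 4 = 3) ^^
        decide ((u' (bxor x w₂) - 2 * sZ (f (bxor x w₂))) % 4 = 3)) := by
  classical
  set e : (Fin (6 + 6) → Bool) → ℤ := fun x => u' x - 2 * sZ (f x) with hedef
  set hb : (Fin (6 + 6) → Bool) → Bool := fun z => decide (e z % 4 = 3) with hbdef
  set hA : (Fin (6 + 6) → Bool) → Bool := fun z => decide (¬ (4 : ℤ) ∣ e z) with hAdef
  -- a transversal `t₀ ∉ V`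
  have huniv : #(univ : Finset (Fin (6 + 6) → Bool)) = 4096 := by
    rw [card_univ, Fintype.card_fun, Fintype.card_bool, Fintype.card_fin]; norm_num
  obtain ⟨t₀, -, ht₀⟩ : ∃ t, t ∈ univ ∧ t ∉ V := exists_mem_notMem_of_card_lt_card (by rw [huniv, hcardV]; norm_num)
  set hb' : (Fin (6 + 6) → Bool) → Bool := fun z => hb z ^^ hA (bxor z t₀) with hb'def
  have hsd := tzi_hsd f g hf hg u' hu' V x₀ h0 hadd hP ht₀ x hx w₁ (hsub hw₁) w₂ (hsub hw₂)
  have hiso := tzi_iso f g hf hg u' hu' V x₀ h0 hadd hcardV hP c V₁ hsub h10 h1add h1card hPc hA2 hper hbud ht₀ hw₁ hw₂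
  change hb' (bxor (bxor x w₁) w₂) = (hb' x ^^ hb' (bxor x w₁) ^^ hb' (bxor x w₂) ^^
    (hb' x₀ ^^ hb' (bxor x₀ w₁) ^^ hb' (bxor x₀ w₂) ^^ hb' (bxor (bxor x₀ w₁) w₂))) at hsd
  change (hb' x₀ ^^ hb' (bxor x₀ w₁) ^^ hb' (bxor x₀ w₂) ^^ hb' (bxor (bxor x₀ w₁) w₂)) = false at hiso
  rw [hiso] at hsd
  -- the twist is constant on the coset
  have hxP : x ∈ univ.filter (fun x : Fin (6 + 6) → Bool => Odd (u' x)) := mem_filter.2 ⟨mem_univ _, hx⟩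
  have hy : ¬ Odd (u' (bxor x t₀)) := fun h => fl1_coset_out h0 hadd hP hxP ht₀ (mem_filter.2 ⟨mem_univ _, h⟩)
  have hconst : ∀ ω ∈ V₁, hA (bxor (bxor x ω) t₀) = hA (bxor x t₀) := by
    intro ω hω
    rw [dv_bxor_right_comm x ω t₀]
    simp only [hA, e, hper ω hω _ hy]
  have h12 : bxor (bxor x w₁) w₂ = bxor x (bxor w₁ w₂) := iw_bxor_assoc x w₁ w₂
  show hb (bxor (bxor x w₁) w₂) = (hb x ^^ hb (bxor x w₁) ^^ hb (bxor x w₂))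
  have e1 : hb (bxor (bxor x w₁) w₂) = (hb' (bxor (bxor x w₁) w₂) ^^ hA (bxor x t₀)) := by
    simp only [hb']; rw [h12, hconst _ (h1add w₁ hw₁ w₂ hw₂)]; cases hb (bxor x (bxor w₁ w₂)) <;> cases hA (bxor x t₀) <;> rfl
  have e2 : hb x = (hb' x ^^ hA (bxor x t₀)) := by
    simp only [hb']; cases hb x <;> cases hA (bxor x t₀) <;> rfl
  have e3 : hb (bxor x w₁) = (hb' (bxor x w₁) ^^ hA (bxor x t₀)) := by
    simp only [hb']; rw [hconst w₁ hw₁]; cases hb (bxor x w₁) <;> cases hA (bxor x t₀) <;> rfl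
  have e4 : hb (bxor x w₂) = (hb' (bxor x w₂) ^^ hA (bxor x t₀)) := by
    simp only [hb']; rw [hconst w₂ hw₂]; cases hb (bxor x w₂) <;> cases hA (bxor x t₀) <;> rfl
  rw [e1, e2, e3, e4, hsd]
  cases hb' x <;> cases hb' (bxor x w₁) <;> cases hb' (bxor x w₂) <;> cases hA (bxor x t₀) <;> rfl

/-- **`Σ_{x∈P} σ₅(x)(−1)^{x·y} ∈ 256ℤ`** on the window in case α (`σ₅ = signOf ∘ hb`; `P` is a union of `V₁`-cosets on each of which `hb` is
relatively affine).  Finite-slice statement, NOT summit progress. [this work] -/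
theorem tzj_sigma_char (f g : (Fin (6 + 6) → Bool) → Bool) (hf : IsDegLeFun 3 f) (hg : IsDegLeFun 3 g)
    (u' : (Fin (6 + 6) → Bool) → ℤ) (hu' : ∀ x, W (fun y => signOf (g y)) x = (2 : ℝ) ^ 5 * (u' x : ℝ))
    (V : Finset (Fin (6 + 6) → Bool)) (x₀ : Fin (6 + 6) → Bool) (h0 : zeroVec ∈ V) (hadd : ∀ a ∈ V, ∀ b ∈ V, bxor a b ∈ V)
    (hcardV : #V = 2048) (hP : (univ.filter fun x : Fin (6 + 6) → Bool => Odd (u' x)) = V.image (bxor x₀))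
    (c : Fin (6 + 6) → Bool) (V₁ : Finset (Fin (6 + 6) → Bool)) (hsub : V₁ ⊆ V) (h10 : zeroVec ∈ V₁)
    (h1add : ∀ a ∈ V₁, ∀ b ∈ V₁, bxor a b ∈ V₁) (h1card : #V₁ = 256)
    (hPc : (univ.filter fun x : Fin (6 + 6) → Bool => ¬ Odd (u' x)) = V.image (bxor c))
    (hA2 : (univ.filter fun y : Fin (6 + 6) → Bool => ¬ Odd (u' y) ∧ ¬ (4 : ℤ) ∣ u' y - 2 * sZ (f y)) = V₁.image (bxor c))
    (hper : ∀ v ∈ V₁, ∀ y, ¬ Odd (u' y) →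
      ((4 : ℤ) ∣ u' (bxor y v) - 2 * sZ (f (bxor y v)) ↔ (4 : ℤ) ∣ u' y - 2 * sZ (f y)))
    (hbud : ∑ x ∈ univ.filter (fun x : Fin (6 + 6) → Bool => Odd (u' x)), ((u' x - 2 * sZ (f x)) ^ 2 - 1) +
        ∑ y ∈ univ.filter (fun y : Fin (6 + 6) → Bool => ¬ Odd (u' y)), (u' y - 2 * sZ (f y)) ^ 2 ≤ 1535)
    (y : Fin (6 + 6) → Bool) :
    ∃ k : ℤ, ∑ x ∈ univ.filter (fun x : Fin (6 + 6) → Bool => Odd (u' x)),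
      signOf (decide ((u' x - 2 * sZ (f x)) % 4 = 3)) * twist x y = 256 * (k : ℝ) := by
  classical
  set hb : (Fin (6 + 6) → Bool) → Bool := fun z => decide ((u' z - 2 * sZ (f z)) % 4 = 3) with hbdef
  set P := univ.filter (fun x : Fin (6 + 6) → Bool => Odd (u' x)) with hPdef
  have hmemP : ∀ x, x ∈ P ↔ Odd (u' x) := fun x => by simp [hPdef]
  set κ : (Fin (6 + 6) → Bool) → Finset (Fin (6 + 6) → Bool) := fun x => V₁.image (bxor x) with hκ
  have haff : ∀ x, Odd (u' x) → ∀ w ∈ V₁, ∀ w' ∈ V₁, hb (bxor (bxor x w) w') = (hb x ^^ hb (bxor x w) ^^ hb (bxor x w')) :=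
    fun x hx w hw w' hw' => tzj_coset_affine f g hf hg u' hu' V x₀ h0 hadd hcardV hP c V₁ hsub h10 h1add h1card hPc hA2 hper
      hbud hx hw hw'
  -- each fibre of `κ` inside `P` is a coset of `V₁`, and its sum is a multiple of `256`
  have hfib : ∀ C : Finset (Fin (6 + 6) → Bool), ∃ k : ℤ,
      ∑ x ∈ P.filter (fun x => κ x = C), signOf (hb x) * twist x y = 256 * (k : ℝ) := by
    intro C
    by_cases hne : (P.filter fun x => κ x = C).Nonempty
    · obtain ⟨x₁, hx₁⟩ := hne
      obtain ⟨hx₁P, hκ₁⟩ := mem_filter.1 hx₁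
      have hset : P.filter (fun x => κ x = C) = V₁.image (bxor x₁) := by
        ext z
        constructor
        · intro hz
          obtain ⟨-, hzκ⟩ := mem_filter.1 hz
          have hzz : z ∈ κ z := mem_image.2 ⟨zeroVec, h10, bxor_zeroVec z⟩
          rw [hzκ, ← hκ₁] at hzz
          exact hzz
        · intro hz
          obtain ⟨w, hw, rfl⟩ := mem_image.1 hz
          refine mem_filter.2 ⟨fl1_coset_vadd hadd hP hx₁P (hsub hw), ?_⟩
          rw [← hκ₁]
          ext u
          simp only [κ, mem_image]
          constructor
          · rintro ⟨v, hv, rfl⟩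
            exact ⟨bxor w v, h1add w hw v hv, by rw [iw_bxor_assoc]⟩
          · rintro ⟨v, hv, rfl⟩
            exact ⟨bxor w v, h1add w hw v hv, by rw [iw_bxor_assoc, bxor_bxor_cancel_left]⟩
      rw [hset]
      obtain ⟨k, -, hk⟩ := tzb_coset_char V₁ h1add x₁ hb (haff x₁ ((hmemP x₁).1 hx₁P)) y
      refine ⟨k, ?_⟩
      rw [hk, h1card]
      push_cast
      ring
    · rw [not_nonempty_iff_eq_empty.1 hne, sum_empty]
      exact ⟨0, by simp⟩
  choose kf hkf using hfib
  have htot := sum_fiberwise_of_maps_to (s := P) (t := P.image κ) (g := κ) (fun x hx => mem_image_of_mem κ hx)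
    (fun x => signOf (hb x) * twist x y)
  refine ⟨∑ C ∈ P.image κ, kf C, ?_⟩
  rw [← htot, sum_congr rfl fun C _ => hkf C, ← mul_sum]
  push_cast
  rfl

end Summit.QuantumAdvantage.QuantumAdvantage.Theorems.CubicForrelation.NearExactIsExact

end
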